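import Literature.Probability.Percolation.SelfRefinementMeasure
import Literature.Probability.Percolation.KohlerSchindlerTassionRSW
import Summits.CriticalPhenomena.CardyFormulaZ2.Theorems.CardySelfRefinementCriticalPathRSWStubCone3Sums

/-!
# Stub `stub_cone3` of line `finite-size-envelope` (crux `CriticalPathRSW`):
the one-sided cone inequality `∂_ρ P + C ∂_c P ≥ 0` for the crossing event of `M_3`

Support file for item `stmt-CriticalPhenomena-10267`, proving the registered stub `stub_cone3` of
the checked skeleton of `CriticalPathRSW` (line `finite-size-envelope`): along every compact
piece `c ≤ 1 - δ` of parameter space the crossing probability of the box `[-3n, 3n] × [-9n, 9n]`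
under the self-refinement model `M_3(ρ, c)` has a nonnegative derivative in the direction
`(1, C)`, `C = 69120000`, uniformly in `ρ ∈ (0, 1)` and `n ≥ 1`.

Proof (parts 1–20, files `…StubCone3*.lean`): by Russo's formula (part 19) the derivative is
`Σ_tuples (P(Â^{σ←1}) - P(Â^{σ←0})) + C Σ_interior P(g pivotal)`; every tuple term is at least
`-1920000 ·` (the pivotality probabilities of eighteen interior labels next to it) (parts 2–18:
tuple-local surgery along short walks, uniformly in `ρ` by using both representations of a
constant tuple state), and these charges overlap at most `36` times (part 20).

References: Aizenman–Grimmett 1991 (essential enhancements); Grimmett 1999 §2.4 (Russo's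
formula); Beffara 2008 §5 (the self-refinement model and the conjectured monotonicity).
-/

noncomputable section

namespace Summit.CriticalPhenomena.CardyFormulaZ2.Cruxes.CriticalPathRSW.FiniteSizeEnvelope

open Set MeasureTheory Filter Topology
open Literature.Probability.LatticeModels Literature.Probability.Percolation

namespace Cone3

variable {n : ℕ} {ρ c : ℝ}

set_option quotPrecheck false

/-- The open labels of a coin configuration. -/
local notation "Op⟪" S "⟫" => {e : Site 2 × Fin 2 | RefinementOpen 3 S e}

/-- The coin law. -/
local notation "P" => (prodBernoulli (refinementParam 3 ρ c))

/-- The pulled-back crossing event. -/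
local notation "Â" => ((refinementConfig 3) ⁻¹' KST2023.crossing (3 * n) (3 * (3 * n)))

/-- Pivotality of the own coin of the interior label `g`. -/
local notation "Piv⟪" g "⟫" =>
  ({S : Set (Site 2 × Fin 2 × Fin 3) |
      edgeConfig ((Op⟪S⟫ \ {g}) ∪ {g}) ∈ KST2023.crossing (3 * n) (3 * (3 * n))} \
    {S : Set (Site 2 × Fin 2 × Fin 3) |
      edgeConfig ((Op⟪S⟫ \ {g}) ∪ ∅) ∈ KST2023.crossing (3 * n) (3 * (3 * n))})

/-- The interior pivotality weight of a label. -/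
local notation "piv⟪" g "⟫" => (if ¬ IsAxialEdge 3 g then (P).real Piv⟪g⟫ else 0)

/-- The charge of the tuple based at `3x` with direction `D` (and `E` the other direction). -/
local notation "PSat⟪" x ", " D ", " E "⟫" => (∑ g ∈ ({((3 : ℤ) • x + (0 : ℤ) • (Pi.single D (1 : ℤ) : Site 2) + (1 : ℤ) • (Pi.single E (1 : ℤ) : Site 2), D), ((3 : ℤ) • x + (1 : ℤ) • (Pi.single D (1 : ℤ) : Site 2) + (0 : ℤ) • (Pi.single E (1 : ℤ) : Site 2), E), ((3 : ℤ) • x + (-1 : ℤ) • (Pi.single D (1 : ℤ) : Site 2) + (0 : ℤ) • (Pi.single E (1 : ℤ) : Site 2), E), ((3 : ℤ) • x + (-1 : ℤ) • (Pi.single D (1 : ℤ) : Site 2) + (1 : ℤ) • (Pi.single E (1 : ℤ) : Site 2), D), ((3 : ℤ) • x + (2 : ℤ) • (Pi.single D (1 : ℤ) : Site 2) + (1 : ℤ) • (Pi.single E (1 : ℤ) : Site 2), D), ((3 : ℤ) • x + (2 : ℤ) • (Pi.single D (1 : ℤ) : Site 2) + (0 : ℤ) • (Pi.single E (1 : ℤ)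 : Site 2), E), ((3 : ℤ) • x + (4 : ℤ) • (Pi.single D (1 : ℤ) : Site 2) + (0 : ℤ) • (Pi.single E (1 : ℤ) : Site 2), E), ((3 : ℤ) • x + (3 : ℤ) • (Pi.single D (1 : ℤ) : Site 2) + (1 : ℤ) • (Pi.single E (1 : ℤ) : Site 2), D), ((3 : ℤ) • x + (1 : ℤ) • (Pi.single D (1 : ℤ) : Site 2) + (1 : ℤ) • (Pi.single E (1 : ℤ) : Site 2), D), ((3 : ℤ) • x + (0 : ℤ) • (Pi.single D (1 : ℤ) : Site 2) + (-1 : ℤ) • (Pi.single E (1 : ℤ) : Site 2), D), ((3 : ℤ) • x + (1 : ℤ) • (Pi.single D (1 : ℤ) : Site 2) + (-1 : ℤ) • (Pi.single E (1 : ℤ) : Site 2), E), ((3 : ℤ) • x + (-1 : ℤ) • (Pi.single D (1 : ℤ) : Site 2) + (-1 : ℤ) • (Pi.single E (1 : ℤ) : Site 2), E), ((3 : ℤ) • x + (-1 : ℤ) • (Pi.single D (1 : ℤ) : Site 2) + (-1 : ℤ) • (Pi.single E (1 : ℤ) : Site 2), D), ((3 : ℤ) • x + (2 : ℤ) • (Pi.single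 D (1 : ℤ) : Site 2) + (-1 : ℤ) • (Pi.single E (1 : ℤ) : Site 2), D), ((3 : ℤ) • x + (2 : ℤ) • (Pi.single D (1 : ℤ) : Site 2) + (-1 : ℤ) • (Pi.single E (1 : ℤ) : Site 2), E), ((3 : ℤ) • x + (4 : ℤ) • (Pi.single D (1 : ℤ) : Site 2) + (-1 : ℤ) • (Pi.single E (1 : ℤ) : Site 2), E), ((3 : ℤ) • x + (3 : ℤ) • (Pi.single D (1 : ℤ) : Site 2) + (-1 : ℤ) • (Pi.single E (1 : ℤ) : Site 2), D), ((3 : ℤ) • x + (1 : ℤ) • (Pi.single D (1 : ℤ) : Site 2) + (-1 : ℤ) • (Pi.single E (1 : ℤ) : Site 2), D)} : Finset (Site 2 × Fin 2)), (P).real Piv⟪g⟫)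

/-- The sites of the square `[-9n, 9n]²`. -/
local notation "Kx" => (Fintype.piFinset fun _ : Fin 2 => Finset.Icc (-(9 * (n : ℤ))) (9 * (n : ℤ)))

/-- The coins based in the square. -/
local notation "Kc" => (Kx ×ˢ (Finset.univ : Finset (Fin 2)) ×ˢ (Finset.univ : Finset (Fin 3)))

/-- The section difference of the coin `i`. -/
local notation "Δ⟪" i "⟫" => ((P).real {S : Set (Site 2 × Fin 2 × Fin 3) | insert i S ∈ Â} -
  (P).real {S : Set (Site 2 × Fin 2 × Fin 3) | S \ {i} ∈ Â})

/-- The lower bound of the Russo terms. -/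
local notation "Gf⟪" C ", " i "⟫" =>
  ((if i.2.2 = 2 then -(1920000 * (if i.2.1 = 0 then PSat⟪i.1, (0 : Fin 2), (1 : Fin 2)⟫
      else PSat⟪i.1, (1 : Fin 2), (0 : Fin 2)⟫)) else (0 : ℝ)) +
    (if i.2.2 = 0 then C * piv⟪(i.1, i.2.1)⟫ else 0))

/-! ### The Russo terms one by one -/

/-- The sections of the crossing event are measurable. -/
theorem measurableSet_sections (i : Site 2 × Fin 2 × Fin 3) :
    MeasurableSet {S : Set (Site 2 × Fin 2 × Fin 3) | insert i S ∈ Â} ∧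
      MeasurableSet {S : Set (Site 2 × Fin 2 × Fin 3) | S \ {i} ∈ Â} := by
  have hAm : MeasurableSet Â := measurableSet_crossing_preimage
  constructor
  · have heq : {S : Set (Site 2 × Fin 2 × Fin 3) | insert i S ∈ Â} =
        (fun ω : Set (Site 2 × Fin 2 × Fin 3) => ω \ ∅ ∪ {i}) ⁻¹' Â := by
      ext S; simp only [Set.mem_setOf_eq, Set.mem_preimage, Set.sdiff_empty, Set.union_singleton]
    rw [heq]; exact measurable_diff_union _ _ hAm
  · have heq : {S : Set (Site 2 × Fin 2 × Fin 3) | S \ {i} ∈ Â} =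
        (fun ω : Set (Site 2 × Fin 2 × Fin 3) => ω \ {i} ∪ ∅) ⁻¹' Â := by
      ext S; simp only [Set.mem_setOf_eq, Set.mem_preimage, Set.union_empty]
    rw [heq]; exact measurable_diff_union _ _ hAm

/-- `P(X) - P(Y) = P(X \ Y) - P(Y \ X)`. -/
theorem real_sub_eq_real_sdiff_sub {X Y : Set (Set (Site 2 × Fin 2 × Fin 3))} (hX : MeasurableSet X) (hY : MeasurableSet Y) :
    (P).real X - (P).real Y = (P).real (X \ Y) - (P).real (Y \ X) := by
  have h1 := measureReal_inter_add_sdiff (μ := P) (s := X) hY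
  have h2 := measureReal_inter_add_sdiff (μ := P) (s := Y) hX
  rw [Set.inter_comm] at h2
  linarith

/-- **The selector terms.** -/
theorem selector_term_ge (hn : 1 ≤ n) (hρ0 : 0 ≤ ρ) (hρ1 : ρ ≤ 1) (hc0 : 0 ≤ c) (hc1 : c ≤ 1)
    {d d' : Fin 2} (hd : d' ≠ d) (x : Site 2) :
    -(1920000 * PSat⟪x, d, d'⟫) ≤ Δ⟪(x, d, (2 : Fin 3))⟫ := by
  obtain ⟨hon, hoff⟩ := measurableSet_sections (n := n) (x, d, (2 : Fin 3))
  have h := real_N_le_real_G_add' (n := n) (ρ := ρ) (c := c) (b := x) hd hn hρ0 hρ1 hc0 hc1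
  have hid := real_sub_eq_real_sdiff_sub (ρ := ρ) (c := c) hon hoff
  linarith

/-- **The interior own-coin terms.** -/
theorem own_term_eq {g : Site 2 × Fin 2} (hg : ¬ IsAxialEdge 3 g) : Δ⟪(g.1, g.2, (0 : Fin 3))⟫ = (P).real Piv⟪g⟫ := by
  rw [section_own_on (n := n) hg, section_own_off (n := n) hg, measureReal_sdiff]
  · exact Z_mono_open _ (Set.empty_subset _)
  · exact measurableSet_Z _ _

/-- **Every Russo term dominates its lower bound.** -/
theorem G_le_term (hn : 1 ≤ n) (hρ0 : 0 ≤ ρ) (hρ1 : ρ ≤ 1) (hc0 : 0 ≤ c) (hc1 : c ≤ 1) (C : ℝ)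
    (i : Site 2 × Fin 2 × Fin 3) :
    Gf⟪C, i⟫ ≤ (fun i : Site 2 × Fin 2 × Fin 3 =>
      if i.2.2 = 2 then (1 : ℝ) else if i.2.2 = 0 ∧ ¬ IsAxialEdge 3 (i.1, i.2.1) then C else 0) i * Δ⟪i⟫ := by
  obtain ⟨x, e, r⟩ := i
  have h10 : (1 : Fin 2) ≠ 0 := by decide
  have h01 : (0 : Fin 2) ≠ 1 := by decide
  fin_cases r
  · -- own coin
    show (if (0 : Fin 3) = 2 then -(1920000 * (if e = 0 then PSat⟪x, (0 : Fin 2), (1 : Fin 2)⟫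
        else PSat⟪x, (1 : Fin 2), (0 : Fin 2)⟫)) else (0 : ℝ)) + (if (0 : Fin 3) = 0 then C * piv⟪(x, e)⟫ else 0) ≤
      (if (0 : Fin 3) = 2 then (1 : ℝ) else if (0 : Fin 3) = 0 ∧ ¬ IsAxialEdge 3 (x, e) then C else 0) *
        Δ⟪(x, e, (0 : Fin 3))⟫
    have e02 : ¬ ((0 : Fin 3) = 2) := by decide
    rw [if_neg e02, if_neg e02, if_pos (rfl : (0 : Fin 3) = 0), zero_add]
    by_cases hax : IsAxialEdge 3 (x, e)
    · rw [if_neg (not_not.2 hax), if_neg (fun h => h.2 hax), mul_zero, zero_mul]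
    · rw [if_pos hax, if_pos ⟨rfl, hax⟩, own_term_eq (n := n) (g := (x, e)) hax]
  · -- shared coin
    show (if (1 : Fin 3) = 2 then -(1920000 * (if e = 0 then PSat⟪x, (0 : Fin 2), (1 : Fin 2)⟫
        else PSat⟪x, (1 : Fin 2), (0 : Fin 2)⟫)) else (0 : ℝ)) + (if (1 : Fin 3) = 0 then C * piv⟪(x, e)⟫ else 0) ≤
      (if (1 : Fin 3) = 2 then (1 : ℝ) else if (1 : Fin 3) = 0 ∧ ¬ IsAxialEdge 3 (x, e) then C else 0) *
        Δ⟪(x, e, (1 : Fin 3))⟫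
    have e12 : ¬ ((1 : Fin 3) = 2) := by decide
    have e10 : ¬ ((1 : Fin 3) = 0) := by decide
    rw [if_neg e12, if_neg e12, if_neg e10, if_neg (fun h => e10 h.1), add_zero, zero_mul]
  · -- selector
    show (if (2 : Fin 3) = 2 then -(1920000 * (if e = 0 then PSat⟪x, (0 : Fin 2), (1 : Fin 2)⟫
        else PSat⟪x, (1 : Fin 2), (0 : Fin 2)⟫)) else (0 : ℝ)) + (if (2 : Fin 3) = 0 then C * piv⟪(x, e)⟫ else 0) ≤
      (if (2 : Fin 3) = 2 then (1 : ℝ) else if (2 : Fin 3) = 0 ∧ ¬ IsAxialEdge 3 (x, e) then C else 0) *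
        Δ⟪(x, e, (2 : Fin 3))⟫
    have e22 : ((2 : Fin 3) = 2) := rfl
    have e20 : ¬ ((2 : Fin 3) = 0) := by decide
    rw [if_pos e22, if_pos e22, if_neg e20, add_zero, one_mul]
    rcases fin2_eq_or h10 e with rfl | rfl
    · rw [if_pos rfl]; exact selector_term_ge hn hρ0 hρ1 hc0 hc1 h10 x
    · rw [if_neg h10]; exact selector_term_ge hn hρ0 hρ1 hc0 hc1 h01 x

/-! ### Summing the lower bounds -/

/-- **The sum of the lower bounds is nonnegative** for `C = 69120000`. -/
theorem sum_G_nonneg : 0 ≤ ∑ i ∈ Kc, Gf⟪(69120000 : ℝ), i⟫ := by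
  have h10 : (1 : Fin 2) ≠ 0 := by decide
  have h01 : (0 : Fin 2) ≠ 1 := by decide
  rw [Finset.sum_product]
  simp only [Finset.sum_product, Fin.sum_univ_two, Fin.sum_univ_three, Fin.isValue]
  simp only [show ((0 : Fin 3) = 2) = False from propext ⟨by decide, False.elim⟩,
    show ((1 : Fin 3) = 2) = False from propext ⟨by decide, False.elim⟩,
    show ((1 : Fin 3) = 0) = False from propext ⟨by decide, False.elim⟩,
    show ((2 : Fin 3) = 0) = False from propext ⟨by decide, False.elim⟩,
    show ((1 : Fin 2) = 0) = False from propext ⟨by decide, False.elim⟩,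
    if_true, if_false, zero_add, add_zero, Finset.sum_add_distrib, Finset.sum_neg_distrib, ← Finset.mul_sum]
  have hA := sum_PS_le (n := n) (ρ := ρ) (c := c) h10
  have hB := sum_PS_le (n := n) (ρ := ρ) (c := c) h01
  have hnn : ∀ y (e : Fin 2), (0 : ℝ) ≤ piv⟪(y, e)⟫ := by
    intro y e; split_ifs
    · exact le_rfl
    · exact measureReal_nonneg
  have hS0 : 0 ≤ ∑ y ∈ Kx, piv⟪(y, (0 : Fin 2))⟫ := Finset.sum_nonneg fun y _ => hnn y 0
  have hS1 : 0 ≤ ∑ y ∈ Kx, piv⟪(y, (1 : Fin 2))⟫ := Finset.sum_nonneg fun y _ => hnn y 1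
  simp only [Finset.sum_add_distrib] at hA hB
  nlinarith

end Cone3

/-- **Stub `stub_cone3` of the checked skeleton of `CriticalPathRSW` (line `finite-size-envelope`):
the one-sided cone inequality for `M_3`.**  There is `n₃` (`= 1`) such that on every compact piece
`c ≤ 1 - δ` of parameter space, for one constant `C` (`= 69120000`), the derivative at `s = 0` of
`s ↦ M_3(ρ + s, c + C s)(crossing of [-3n, 3n] × [-9n, 9n])` exists and is nonnegative, for all
`n ≥ n₃`, `ρ ∈ (0, 1)`, `c ∈ (0, 1 - δ]`. -/
theorem stub_cone3 : ∃ n₃ : ℕ, ∀ δ : ℝ, 0 < δ → δ < 1 → ∃ C : ℝ, 0 ≤ C ∧ ∀ n : ℕ, n₃ ≤ n → ∀ ρ c : ℝ, 0 < ρ → ρ < 1 → 0 < c → c ≤ 1 - δ → ∃ D : ℝ, 0 ≤ D ∧ HasDerivAt (fun s : ℝ => (selfRefinementMeasure 3 (ρ + s) (c + C * s)).real (KST2023.crossing (3 * n) (3 * (3 * n)))) D 0 := by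
  refine ⟨1, fun δ hδ0 _ => ⟨69120000, by norm_num, fun n hn ρ c hρ0 hρ1 hc0 hcδ => ?_⟩⟩
  have hc1 : c < 1 := by linarith
  refine ⟨_, ?_, Cone3.hasDerivAt_crossing (n := n) (C := 69120000) hρ0 hρ1 hc0 hc1⟩
  exact (Cone3.sum_G_nonneg (n := n) (ρ := ρ) (c := c)).trans
    (Finset.sum_le_sum fun i _ => Cone3.G_le_term hn hρ0.le hρ1.le hc0.le hc1.le 69120000 i)

end Summit.CriticalPhenomena.CardyFormulaZ2.Cruxes.CriticalPathRSW.FiniteSizeEnvelope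

end
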